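import Literature.Probability.LatticeModels.HalfSpaceFolding
import Literature.Probability.LatticeModels.InfiniteClusterTail
import HarnessLib

/-!
# No infinite butterflies across a coordinate hyperplane ⇒ flip-reflection invariance
# (Georgii–Higuchi 2000, Lemma 3.1, Step 1)

Topic `Probability/LatticeModels`. Georgii–Higuchi, J. Math. Phys. 41 (2000), proof of Lemma 3.1,
Step 1 (p. 7): for an extremal `μ` with no infinite butterfly, "we observe that `μ` is
`R∘T`-invariant for all reflections `R` … Indeed, let `(π, π′)` be conjugate half-planes with
common boundary line `ℓ` and `R` the reflection in `ℓ` mapping `π` onto `π′`. By the absence of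
infinite butterflies, at least one of the half-planes `π` and `π′` contains no infinite `-`cluster,
and this or the other half-plane contains no infinite `+`cluster. In view of the tail triviality
of `μ`, we can assume that `μ(E⁻_π) = 0` … By Lemma 2.2, this gives the flip-reflection
domination `μ ≽ μ∘R∘T`. Since also `μ(E⁺_π) = 0` or `μ(E⁺_{π′}) = 0`, we conclude in the same
way that `μ ≼ μ∘R∘T`, so that `μ = μ∘R∘T`." We prove this for the zero-field Ising model on `ℤ^d`
(any `d`, `β ≥ 0`), the reflection `R = reflectCoord i` and the half-spaces `{x_i ≥ 0}`,
`{x_i ≤ 0}`, for a **tail-trivial** Gibbs measure: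

* `existsInfClusterIn G s P` — "there is an infinite `s`-cluster inside `P`" (`E^±_π`), a tail
  event (`measurableSet_tailEvents_existsInfClusterIn`);
* `integral_flipRelabel_le_of_halfSpace` — Lemma 2.2 made effective: if `μ(E⁻_{π}) = 0` for the
  upper or the lower half-space then `μ ≽ μ∘R∘T` (`HalfSpaceFolding` + `EnclosureCriterion` +
  `FlipReflectionDomination`);
* **`map_flipRelabel_eq_of_no_butterfly`** — if `μ` is tail trivial and a.s. has neither an
  infinite `-`butterfly nor an infinite `+`butterfly across `{x_i = 0}`, then `μ ∘ (R∘T)⁻¹ = μ`.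

## References

* H.-O. Georgii, Y. Higuchi, J. Math. Phys. 41 (2000) 1153–1169, Lemma 3.1, Step 1 of the
  proof, p. 7 [GeorgiiHiguchi2000].
-/

noncomputable section

open MeasureTheory Filter Topology Finset
open Literature.Probability.Percolation (siteCluster sitePercolatesAt)

namespace Literature.Probability.LatticeModels

/-! ### Infinite clusters inside a region -/

section Region

variable {V : Type*} {G : SimpleGraph V}

/-- `E^s_P`: there is an infinite `s`-cluster inside the region `P` — some cluster of the subgraph
of `G` induced on `S^s(ω) ∩ P` is infinite (Georgii–Higuchi 2000, §3, p. 6: "`E⁺_π` denote the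
event that there exists an infinite `+`cluster in `π`"). [cite: GeorgiiHiguchi2000, §3 p. 6] -/
def existsInfClusterIn (G : SimpleGraph V) (s : ℤˣ) (P : Set V) : Set (SpinConfig V) :=
  {ω | ∃ x, (siteCluster G (spinSites s ω ∩ P) x).Infinite}

/-- Membership in `E^s_P`. [cite: GeorgiiHiguchi2000, §3 p. 6] -/
theorem mem_existsInfClusterIn_iff {s : ℤˣ} {P : Set V} {ω : SpinConfig V} :
    ω ∈ existsInfClusterIn G s P ↔ ∃ x, (siteCluster G (spinSites s ω ∩ P) x).Infinite := Iff.rfl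

/-- `ω ↦ (S^s(ω) ∩ P) \ Λ` is measurable with respect to the spins outside `Λ`. [cite: GeorgiiHiguchi2000, §3 p. 6] -/
theorem measurable_spinSites_inter_diff (s : ℤˣ) (P : Set V) (Λ : Finset V) :
    Measurable[cylinderEvents (X := fun _ : V => ℤˣ) ((↑Λ : Set V)ᶜ)]
      fun ω : SpinConfig V => (spinSites s ω ∩ P) \ ↑Λ := by
  classical
  refine @measurable_set_iff _ _ (cylinderEvents (X := fun _ : V => ℤˣ) ((↑Λ : Set V)ᶜ)) _
    |>.2 fun a => ?_
  by_cases ha : a ∈ (↑Λ : Set V) ∨ a ∉ P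
  · have : (fun ω : SpinConfig V => a ∈ (spinSites s ω ∩ P) \ ↑Λ) = fun _ => False := by
      funext ω
      rcases ha with ha | ha <;> simp [ha]
    rw [this]
    exact @measurable_const Prop (SpinConfig V) _
      (cylinderEvents (X := fun _ : V => ℤˣ) ((↑Λ : Set V)ᶜ)) False
  · push Not at ha
    have : (fun ω : SpinConfig V => a ∈ (spinSites s ω ∩ P) \ ↑Λ) = fun ω => ω a = s := by
      funext ω; simp [ha.1, ha.2]
    rw [this]
    have hcoord : Measurable[cylinderEvents (X := fun _ : V => ℤˣ) ((↑Λ : Set V)ᶜ)]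
        fun ω : SpinConfig V => ω a :=
      measurable_cylinderEvent_apply (X := fun _ : V => ℤˣ) ha.1
    exact hcoord.eq_const s

/-- **`E^s_P ∈ 𝓕_{Λᶜ}` for every finite `Λ`** (as for `E^s`: closing finitely many sites does not
affect the existence of an infinite cluster, `exists_infinite_siteCluster_diff_iff`). [cite: GeorgiiHiguchi2000, Lemma 3.1 (proof, p. 7)] -/
theorem measurableSet_cylinderEvents_existsInfClusterIn [DecidableEq V] [G.LocallyFinite]
    [Countable V] (s : ℤˣ) (P : Set V) (Λ : Finset V) :
    MeasurableSet[cylinderEvents (X := fun _ : V => ℤˣ) ((↑Λ : Set V)ᶜ)] (existsInfClusterIn G s P) := by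
  have hE : existsInfClusterIn G s P =
      (fun ω : SpinConfig V => (spinSites s ω ∩ P) \ ↑Λ) ⁻¹' (⋃ x, sitePercolatesAt G x) := by
    ext ω
    simp only [mem_existsInfClusterIn_iff, Set.mem_preimage, Set.mem_iUnion, sitePercolatesAt,
      Set.mem_setOf_eq]
    exact (exists_infinite_siteCluster_diff_iff (G := G) (spinSites s ω ∩ P) Λ).symm
  rw [hE]
  exact measurable_spinSites_inter_diff s P Λ
    (MeasurableSet.iUnion fun x => measurableSet_sitePercolatesAt x)

/-- **`E^s_P` is a tail event** (Georgii–Higuchi 2000, proof of Lemma 3.1, p. 7). [cite: GeorgiiHiguchi2000, Lemma 3.1 (proof, p. 7)] -/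
theorem measurableSet_tailEvents_existsInfClusterIn [DecidableEq V] [G.LocallyFinite] [Countable V]
    (s : ℤˣ) (P : Set V) : MeasurableSet[tailEvents V ℤˣ] (existsInfClusterIn G s P) :=
  measurableSet_tailEvents_iff.2 fun Λ => measurableSet_cylinderEvents_existsInfClusterIn s P Λ

/-- Under a tail-trivial measure, `E^s_P` has probability `0` or `1` (Georgii–Higuchi 2000, p. 7:
"In view of the tail triviality of `μ`, we can assume that `μ(E⁻_π) = 0`"). [cite: GeorgiiHiguchi2000, Lemma 3.1 (proof, p. 7)] -/
theorem IsTailTrivial.measure_existsInfClusterIn [DecidableEq V] [G.LocallyFinite] [Countable V]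
    {μ : Measure (SpinConfig V)} (hμ : IsTailTrivial μ) (s : ℤˣ) (P : Set V) :
    μ (existsInfClusterIn G s P) = 0 ∨ μ (existsInfClusterIn G s P) = 1 :=
  hμ _ (measurableSet_tailEvents_existsInfClusterIn s P)

/-- The flip exchanges `E^s_P` and `E^{-s}_P`: `S^s(-ω) = S^{-s}(ω)`. [cite: GeorgiiHiguchi2000, §2 p. 4] -/
theorem neg_mem_existsInfClusterIn_iff {s : ℤˣ} {P : Set V} {ω : SpinConfig V} :
    -ω ∈ existsInfClusterIn G s P ↔ ω ∈ existsInfClusterIn G (-s) P := by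
  have h : spinSites s (-ω) = spinSites (-s) ω := by
    ext x; simp only [mem_spinSites, Pi.neg_apply]; exact neg_eq_iff_eq_neg
  simp only [mem_existsInfClusterIn_iff, h]

end Region

/-! ### Lemma 2.2 made effective by folding -/

section Zd

variable {d : ℕ} {β : ℝ}

/-- Negation reverses the order on `{±1}`. [folklore] -/
theorem units_neg_le_neg {u v : ℤˣ} (h : u ≤ v) : -v ≤ -u := by
  rcases Int.units_eq_one_or u with rfl | rfl <;> rcases Int.units_eq_one_or v with rfl | rfl
  · exact le_rfl
  · exact absurd h (by decide)
  · decide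
  · exact le_rfl

/-- The events `{Δ ⊆ explVolume B(n) (bad sites)}` are measurable. [cite: GeorgiiHiguchi2000, Lemma 2.2 (p. 5)] -/
theorem measurableSet_subset_explVolume_badSites (i : Fin d) (Δ : Finset (Site d)) (n : ℕ) :
    MeasurableSet {ω : SpinConfig (Site d) |
      Δ ⊆ explVolume (zdGraph d) (box d n) (badSites (reflectCoord i).toEquiv ω)} := by
  have hU : {ω : SpinConfig (Site d) |
      Δ ⊆ explVolume (zdGraph d) (box d n) (badSites (reflectCoord i).toEquiv ω)} =
      ⋃ S ∈ (box d n).powerset.filter (fun S => Δ ⊆ S),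
        {ω | explVolume (zdGraph d) (box d n) (badSites (reflectCoord i).toEquiv ω) = S} := by
    ext ω
    simp only [Set.mem_setOf_eq, Set.mem_iUnion, Finset.mem_filter, Finset.mem_powerset,
      exists_prop]
    constructor
    · intro hΔ
      exact ⟨_, ⟨explVolume_subset _ _, hΔ⟩, rfl⟩
    · rintro ⟨S, ⟨-, hΔS⟩, hS⟩
      rwa [hS]
  rw [hU]
  refine Finset.measurableSet_biUnion _ fun S _ => ?_
  exact cylinderEvents_le_pi _ (measurableSet_explVolume_badSites_eq (reflectCoord i)
    (reflectCoord_reflectCoord i) (box_map_reflectCoord i n) S)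

/-- **Flip-reflection domination from the absence of `-`percolation in a half-space**
(Georgii–Higuchi 2000, proof of Lemma 3.1, Step 1, p. 7, combining "`μ(E⁻_π) = 0`" with
Lemma 2.2): for `β ≥ 0`, `μ ∈ 𝒢(β, 0)` on `ℤ^d` and a coordinate `i`, if `μ`-a.s. there is no
infinite `-`cluster in `{x_i ≥ 0}`, or `μ`-a.s. none in `{x_i ≤ 0}`, then
`∫ f ∘ R∘T dμ ≤ ∫ f dμ` for every nondecreasing local bounded measurable `f`, where `R` is the
reflection in `{x_i = 0}`. [cite: GeorgiiHiguchi2000, Lemma 3.1 (proof, Step 1, p. 7)] -/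
theorem integral_flipRelabel_le_of_halfSpace (hβ : 0 ≤ β) {μ : Measure (SpinConfig (Site d))}
    (hμ : μ ∈ isingGibbsMeasures d β 0) (i : Fin d)
    (hπ : μ (existsInfClusterIn (zdGraph d) (-1) (upperHalfSpace i)) = 0 ∨
      μ (existsInfClusterIn (zdGraph d) (-1) (lowerHalfSpace i)) = 0)
    {f : SpinConfig (Site d) → ℝ} (hf : Monotone f) (hfm : Measurable f) {Δ : Finset (Site d)}
    (hfD : DependsOn f (↑Δ : Set (Site d))) {C : ℝ} (hC : ∀ σ, |f σ| ≤ C) :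
    ∫ σ, f (flipRelabel (reflectCoord i).toEquiv σ) ∂μ ≤ ∫ σ, f σ ∂μ := by
  have hμG : IsGibbsMeasure (isingSpecification (zdGraph d) β 0) μ := hμ
  haveI := hμG.isProbabilityMeasure
  have hnull : ∀ t : Site d,
      μ {ω | badSites (reflectCoord i).toEquiv ω ∈ sitePercolatesAt (zdGraph d) t} = 0 := by
    rcases hπ with h | h
    · exact measure_badSites_percolates_eq_zero_of_upper i μ h
    · exact measure_badSites_percolates_eq_zero_of_lower i μ h
  have hencl : ∀ Δ' : Finset (Site d), Tendsto (fun n => μ {ω : SpinConfig (Site d) |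
      Δ' ⊆ explVolume (zdGraph d) (box d n) (badSites (reflectCoord i).toEquiv ω)}ᶜ) atTop (𝓝 0) :=
    fun Δ' => tendsto_measure_not_subset_explVolume_of μ (fun ω => badSites (reflectCoord i).toEquiv ω)
      Δ' (measurableSet_subset_explVolume_badSites i Δ') hnull
  exact integral_flipRelabel_le_of_enclosure hβ (reflectCoord i) (reflectCoord_reflectCoord i) hμG
    (box d) (box_map_reflectCoord i) hencl hf hfm hfD hC

/-! ### The flipped measure -/

/-- The flip is measurable for every outside σ-algebra `𝓕_Δ` (coordinatewise). [folklore] -/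
theorem measurable_neg_cylinderEvents {V : Type*} (Δ : Set V) :
    @Measurable (SpinConfig V) (SpinConfig V) (cylinderEvents (X := fun _ : V => ℤˣ) Δ)
      (cylinderEvents (X := fun _ : V => ℤˣ) Δ) fun σ => -σ := by
  refine @measurable_cylinderEvents_iff _ _ _ (cylinderEvents (X := fun _ : V => ℤˣ) Δ) _ _ _ |>.2 ?_
  intro x hx
  have hcoord : Measurable[cylinderEvents (X := fun _ : V => ℤˣ) Δ] fun σ : SpinConfig V => σ x :=
    measurable_cylinderEvent_apply (X := fun _ : V => ℤˣ) hx
  exact measurable_neg.comp hcoord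

/-- **Tail triviality is preserved by the flip.** [cite: GeorgiiHiguchi2000, §2 p. 3] -/
theorem IsTailTrivial.map_neg {V : Type*} {μ : Measure (SpinConfig V)} (hμ : IsTailTrivial μ) :
    IsTailTrivial (μ.map fun σ : SpinConfig V => -σ) := by
  intro B hB
  have hBn : MeasurableSet[tailEvents V ℤˣ] ((fun σ : SpinConfig V => -σ) ⁻¹' B) := by
    rw [measurableSet_tailEvents_iff] at hB ⊢
    exact fun Λ => measurable_neg_cylinderEvents _ (hB Λ)
  rw [Measure.map_apply measurable_neg (MeasurableSet.of_tailEvents hB)]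
  exact hμ _ hBn

/-- The flipped measure of `E^s_P` is the measure of `E^{-s}_P`. [cite: GeorgiiHiguchi2000, §2 p. 4] -/
theorem map_neg_existsInfClusterIn {V : Type*} {G : SimpleGraph V} [DecidableEq V]
    [G.LocallyFinite] [Countable V] (μ : Measure (SpinConfig V)) (s : ℤˣ) (P : Set V) :
    (μ.map fun σ : SpinConfig V => -σ) (existsInfClusterIn G s P) = μ (existsInfClusterIn G (-s) P) := by
  rw [Measure.map_apply measurable_neg
    (MeasurableSet.of_tailEvents (measurableSet_tailEvents_existsInfClusterIn s P))]
  congr 1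
  ext ω
  exact neg_mem_existsInfClusterIn_iff

/-- The flipped measure of an intersection `E^s_P ∩ E^s_{P'}` (a butterfly event). [cite: GeorgiiHiguchi2000, §3 p. 6] -/
theorem map_neg_existsInfClusterIn_inter {V : Type*} {G : SimpleGraph V} [DecidableEq V]
    [G.LocallyFinite] [Countable V] (μ : Measure (SpinConfig V)) (s : ℤˣ) (P P' : Set V) :
    (μ.map fun σ : SpinConfig V => -σ) (existsInfClusterIn G s P ∩ existsInfClusterIn G s P') =
      μ (existsInfClusterIn G (-s) P ∩ existsInfClusterIn G (-s) P') := by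
  rw [Measure.map_apply measurable_neg
    ((MeasurableSet.of_tailEvents (measurableSet_tailEvents_existsInfClusterIn s P)).inter
      (MeasurableSet.of_tailEvents (measurableSet_tailEvents_existsInfClusterIn s P')))]
  congr 1
  ext ω
  simp only [Set.mem_preimage, Set.mem_inter_iff]
  exact and_congr neg_mem_existsInfClusterIn_iff neg_mem_existsInfClusterIn_iff

/-! ### Lemma 3.1, Step 1 -/

/-- From tail triviality: if the butterfly event `E^s_P ∩ E^s_{P'}` is null then one of its wings
is null. [cite: GeorgiiHiguchi2000, Lemma 3.1 (proof, Step 1, p. 7)] -/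
theorem measure_existsInfClusterIn_eq_zero_or {V : Type*} {G : SimpleGraph V} [DecidableEq V]
    [G.LocallyFinite] [Countable V] {μ : Measure (SpinConfig V)} [IsProbabilityMeasure μ]
    (hμt : IsTailTrivial μ) (s : ℤˣ) (P P' : Set V)
    (h0 : μ (existsInfClusterIn G s P ∩ existsInfClusterIn G s P') = 0) :
    μ (existsInfClusterIn G s P) = 0 ∨ μ (existsInfClusterIn G s P') = 0 := by
  rcases hμt.measure_existsInfClusterIn (G := G) s P with h1 | h1
  · exact Or.inl h1
  rcases hμt.measure_existsInfClusterIn (G := G) s P' with h2 | h2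
  · exact Or.inr h2
  exfalso
  have hP : MeasurableSet (existsInfClusterIn G s P) :=
    MeasurableSet.of_tailEvents (measurableSet_tailEvents_existsInfClusterIn s P)
  have hP' : MeasurableSet (existsInfClusterIn G s P') :=
    MeasurableSet.of_tailEvents (measurableSet_tailEvents_existsInfClusterIn s P')
  have : μ (existsInfClusterIn G s P ∩ existsInfClusterIn G s P') = 1 := by
    have hc1 : μ (existsInfClusterIn G s P)ᶜ = 0 := (prob_compl_eq_zero_iff hP).2 h1
    have hc2 : μ (existsInfClusterIn G s P')ᶜ = 0 := (prob_compl_eq_zero_iff hP').2 h2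
    have hc : μ (existsInfClusterIn G s P ∩ existsInfClusterIn G s P')ᶜ = 0 := by
      rw [Set.compl_inter]
      exact measure_union_null hc1 hc2
    exact (prob_compl_eq_zero_iff (hP.inter hP')).1 hc
  rw [h0] at this
  exact zero_ne_one this

/-- **Georgii–Higuchi 2000, Lemma 3.1, Step 1: no infinite butterflies across `{x_i = 0}` ⇒ `μ`
is `R∘T`-invariant.** Zero-field Ising model on `ℤ^d`, `β ≥ 0`, `μ ∈ 𝒢(β, 0)` tail trivial; if
`μ`-almost surely there is no pair of infinite `-`clusters, one in `{x_i ≥ 0}` and one in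
`{x_i ≤ 0}`, and likewise for `+`, then `μ ∘ (R∘T)⁻¹ = μ` for the reflection `R` in
`{x_i = 0}`. Proof as printed (p. 7): tail triviality makes one `-`wing null, so `μ ≽ μ∘R∘T`
(`integral_flipRelabel_le_of_halfSpace`); the same for the flipped measure (whose `-`wings are the
`+`wings of `μ`) gives `μ ≼ μ∘R∘T`; a probability measure on `{±1}^{ℤ^d}` is determined by the
expectations of nondecreasing local observables. [cite: GeorgiiHiguchi2000, Lemma 3.1 (proof, Step 1, p. 7)] -/
theorem map_flipRelabel_eq_of_no_butterfly (hβ : 0 ≤ β) {μ : Measure (SpinConfig (Site d))}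
    (hμ : μ ∈ isingGibbsMeasures d β 0) (hμt : IsTailTrivial μ) (i : Fin d)
    (hminus : μ (existsInfClusterIn (zdGraph d) (-1) (upperHalfSpace i) ∩
      existsInfClusterIn (zdGraph d) (-1) (lowerHalfSpace i)) = 0)
    (hplus : μ (existsInfClusterIn (zdGraph d) 1 (upperHalfSpace i) ∩
      existsInfClusterIn (zdGraph d) 1 (lowerHalfSpace i)) = 0) :
    μ.map (flipRelabel (reflectCoord i).toEquiv) = μ := by
  have hμG : IsGibbsMeasure (isingSpecification (zdGraph d) β 0) μ := hμ
  haveI := hμG.isProbabilityMeasure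
  set RT := flipRelabel (reflectCoord i).toEquiv with hRT
  have hRTm : Measurable RT := measurable_flipRelabel _
  haveI : IsProbabilityMeasure (μ.map RT) := Measure.isProbabilityMeasure_map hRTm.aemeasurable
  -- `μ ≽ μ ∘ R∘T`
  have hge : ∀ (f : SpinConfig (Site d) → ℝ), Monotone f → Measurable f →
      (∃ Λ : Finset (Site d), DependsOn f (↑Λ : Set (Site d))) → (∃ C, ∀ σ, |f σ| ≤ C) →
        ∫ σ, f (RT σ) ∂μ ≤ ∫ σ, f σ ∂μ := by
    intro f hf hfm ⟨Λ, hΛ⟩ ⟨C, hC⟩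
    exact integral_flipRelabel_le_of_halfSpace hβ hμ i
      (measure_existsInfClusterIn_eq_zero_or hμt (-1) _ _ hminus) hf hfm hΛ hC
  -- `μ ≼ μ ∘ R∘T`, from the flipped measure
  have hle : ∀ (f : SpinConfig (Site d) → ℝ), Monotone f → Measurable f →
      (∃ Λ : Finset (Site d), DependsOn f (↑Λ : Set (Site d))) → (∃ C, ∀ σ, |f σ| ≤ C) →
        ∫ σ, f σ ∂μ ≤ ∫ σ, f (RT σ) ∂μ := by
    intro f hf hfm ⟨Λ, hΛ⟩ ⟨C, hC⟩
    set μ' : Measure (SpinConfig (Site d)) := μ.map fun σ => -σ with hμ'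
    have hμ'G : μ' ∈ isingGibbsMeasures d β 0 := isGibbsMeasure_map_neg (zdGraph d) β hμG
    have hμ't : IsTailTrivial μ' := hμt.map_neg
    haveI : IsProbabilityMeasure μ' := (show IsGibbsMeasure _ μ' from hμ'G).isProbabilityMeasure
    have hminus' : μ' (existsInfClusterIn (zdGraph d) (-1) (upperHalfSpace i) ∩
        existsInfClusterIn (zdGraph d) (-1) (lowerHalfSpace i)) = 0 := by
      rw [hμ', map_neg_existsInfClusterIn_inter, neg_neg]; exact hplus
    -- the observable `f'' σ = -f(-σ)`
    set g : SpinConfig (Site d) → ℝ := fun σ => -f (-σ) with hg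
    have hgmono : Monotone g := fun σ τ hστ =>
      neg_le_neg (hf fun x => units_neg_le_neg (hστ x))
    have hgm : Measurable g := (hfm.comp measurable_neg).neg
    have hgD : DependsOn g (↑Λ : Set (Site d)) := fun σ τ hστ => by
      have hf' : f (-σ) = f (-τ) := hΛ fun x hx => by
        show (-σ) x = (-τ) x
        rw [Pi.neg_apply, Pi.neg_apply, hστ x hx]
      simp only [hg, hf']
    have hgC : ∀ σ, |g σ| ≤ C := fun σ => by rw [hg, abs_neg]; exact hC _
    have key := integral_flipRelabel_le_of_halfSpace hβ hμ'G i
      (measure_existsInfClusterIn_eq_zero_or hμ't (-1) _ _ hminus') hgmono hgm hgD hgC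
    -- unfold the flipped measure
    have e1 : ∫ σ, g (flipRelabel (reflectCoord i).toEquiv σ) ∂μ' = ∫ σ, g (RT (-σ)) ∂μ :=
      integral_map measurable_neg.aemeasurable (hgm.comp hRTm).aestronglyMeasurable
    have e2 : ∫ σ, g σ ∂μ' = ∫ σ, g (-σ) ∂μ :=
      integral_map measurable_neg.aemeasurable hgm.aestronglyMeasurable
    rw [e1, e2] at key
    have h1 : ∀ σ : SpinConfig (Site d), g (RT (-σ)) = -f (RT σ) := fun σ => by
      simp only [hg, hRT]
      congr 1
      congr 1
      funext z
      simp [flipRelabel_apply]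
    have h2 : ∀ σ : SpinConfig (Site d), g (-σ) = -f σ := fun σ => by simp [hg]
    simp_rw [h1, h2, integral_neg] at key
    linarith
  -- equality on nondecreasing local observables determines the measure
  refine measure_eq_of_forall_integral_monotone_local_eq _ _ fun f hf hfm hloc hbd => ?_
  rw [integral_map hRTm.aemeasurable hfm.aestronglyMeasurable]
  exact le_antisymm (hge f hf hfm hloc hbd) (hle f hf hfm hloc hbd)

end Zd

end Literature.Probability.LatticeModels
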